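import Literature.Computability.QuantumComplexity.ZXCalculusLeafCycle
import HarnessLib

/-!
# ZX-calculus: JPV LICS 2019, Lemma `2-triangle-cycle` (`Z^{(1,2)} ⨾ (T ⊗ Tᵗ) ⨾ Z^{(2,1)} = 𝕀`)

[cite: JeandelPerdrixVilmart2019nf, Appendix Lemma 2-triangle-cycle]; own route in the style of `first36_core`:
gadget cancellation, `L10ᵀ`, the hedge, (C1), an `H`-loop, and the leafy four-cycle.
-/

namespace Literature.Computability.QuantumComplexity

open ZXDiagram

namespace ZXClass

/-- **Core of the two-triangle cycle (transposed, after gadget cancellation)**: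
`db 4 (-1) ⊗ (Z^{(1,2)} ⨾ ((X(π/2) ⨾ Z(π/4) ⨾ xLeafL 0 (π/4)) ⊗ (X(π/2) ⨾ Z(-π/4) ⨾ xLeafL 0 (π/4))) ⨾ Z^{(2,1)})
= √2 ⊗ (X(π/2) ⨾ Z^{(1,2)} ⨾ (xLeafL π (-π/4) ⊗ xLeafL 0 (π/4)) ⨾ Z^{(2,1)})`. [cite: JeandelPerdrixVilmart2018, Appendix Lemmas 10, 17] -/
theorem two_triangle_core :
    mk (dumbbell 4 (-1)) ⊠ (mk (Z 1 2 0) ⨟ ((mk (X 1 1 2) ⨟ mk (Z 1 1 1) ⨟ mk (xLeafL 0 1)) ⊠ (mk (X 1 1 2) ⨟ mk (Z 1 1 (-1)) ⨟ mk (xLeafL 0 1))) ⨟ mk (Z 2 1 0)) =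
      mk (dumbbell 0 0) ⊠ (mk (X 1 1 2) ⨟ mk (Z 1 2 0) ⨟ (mk (xLeafL 4 (-1)) ⊠ mk (xLeafL 0 1)) ⨟ mk (Z 2 1 0)) := by
  have h10T : mk (Z 1 2 0) ⨟ (mk (X 1 1 2) ⊠ mk (X 1 1 2)) =
      mk (dumbbell 0 0) ⊠ (mk (X 1 1 2) ⨟ (mk (Z 1 2 4) ⨟ ((mk (wires 1) ⊠ mk hBox) ⨟ ((mk (wires 1) ⊠ mk (Z 1 2 0)) ⨟ (((mk hBox ⊠ mk hBox) ⨟ mk (Z 2 1 0)) ⊠ mk (wires 1)))))) := by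
    have h := congrArg transpose X_halfpis_seq_Z_merge
    simpa using h
  have hC : (mk (wires 1) ⊠ mk (Z 1 2 0)) ⨟ (((mk hBox ⊠ mk hBox) ⨟ mk (Z 2 1 0)) ⊠ mk (wires 1)) =
      (mk hBox ⊠ mk (wires 1)) ⨟ (mk (Z 1 2 0) ⊠ mk (Z 1 2 0)) ⨟ ((mk (wires 1) ⊠ ((mk hBox ⊠ mk (wires 1)) ⨟ mk cap)) ⊠ mk (wires 1)) := by
    rw [← hBox_par_split_hBox_seq_merge, seq_par_wires, ← seq_assoc,
      show (mk hBox ⊠ mk hBox) ⊠ mk (wires 1) = mk hBox ⊠ (mk hBox ⊠ mk (wires 1)) from (par_assoc _ _ _).trans (cast_id _ _ _), interchange, id_seq]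
  have hK : mk (dumbbell 4 (-1)) ⊠ mk (xLeafL 0 1) = mk (dumbbell 0 0) ⊠ mk (xLeafL 4 (-1)) := by
    simpa using (dumbbell_four_par_xLeafL_neg 0 (-1))
  have hRl : ∀ (A B : ZXClass 1 1) (t : ZXClass 0 0), A ⊠ (t ⊠ B) = t ⊠ (A ⊠ B) := fun A B t => by
    rw [show A ⊠ (t ⊠ B) = (A ⊠ t) ⊠ B from (par_assoc' _ _ _).trans (cast_id _ _ _), ← scalar_par_one_comm]
    exact (par_assoc _ _ _).trans (cast_id _ _ _)
  rw [seq_assoc (mk (X 1 1 2)) (mk (Z 1 1 1)) (mk (xLeafL 0 1)), seq_assoc (mk (X 1 1 2)) (mk (Z 1 1 (-1))) (mk (xLeafL 0 1)), ← interchange,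
    ← seq_assoc (mk (Z 1 2 0)), h10T]
  simp only [seq_assoc]
  rw [hC, scalar_par_one_two_seq_one]
  simp only [seq_assoc]
  -- Step D: phases into the splits
  rw [← interchange, seq_assoc (mk (Z 1 1 1) ⊠ mk (Z 1 1 (-1))), ← seq_assoc ((mk (wires 1) ⊠ ((mk hBox ⊠ mk (wires 1)) ⨟ mk cap)) ⊠ mk (wires 1)) (mk (Z 1 1 1) ⊠ mk (Z 1 1 (-1))),
    ← seq_assoc (mk (Z 1 2 0) ⊠ mk (Z 1 2 0)) (((mk (wires 1) ⊠ ((mk hBox ⊠ mk (wires 1)) ⨟ mk cap)) ⊠ mk (wires 1)) ⨟ (mk (Z 1 1 1) ⊠ mk (Z 1 1 (-1)))),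
    ← seq_assoc (mk (Z 1 2 0) ⊠ mk (Z 1 2 0)) ((mk (wires 1) ⊠ ((mk hBox ⊠ mk (wires 1)) ⨟ mk cap)) ⊠ mk (wires 1)) (mk (Z 1 1 1) ⊠ mk (Z 1 1 (-1))), hedgeSq_seq_phases,
    -- Step E: `H ⊗ H` reordered; flip the right leaf with `db 4 (-1)`
    ← seq_assoc (mk (wires 1) ⊠ mk hBox) (mk hBox ⊠ mk (wires 1)),
    show (mk (wires 1) ⊠ mk hBox) ⨟ (mk hBox ⊠ mk (wires 1)) = (mk hBox ⊠ mk (wires 1)) ⨟ (mk (wires 1) ⊠ mk hBox) from by rw [← par_eq_seq_right, ← par_eq_seq_left],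
    seq_assoc (mk hBox ⊠ mk (wires 1)) (mk (wires 1) ⊠ mk hBox),
    scalar_par_scalar_par (mk (dumbbell 4 (-1))) (mk (dumbbell 0 0)), ← seq_scalar_par_one (mk (dumbbell 4 (-1))) (mk (X 1 1 2)), ← one_two_seq_scalar_par_one,
    ← two_two_seq_scalar_par_one, ← two_two_seq_scalar_par_one, ← two_two_seq_scalar_par_one,
    ← scalar_par_two_two_seq_one (mk (dumbbell 4 (-1))) (mk (xLeafL 0 1) ⊠ mk (xLeafL 0 1)), ← hRl, hK, hRl, xLeafL_eq_xLeafR 4 (-1),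
    scalar_par_two_two_seq_one, two_two_seq_scalar_par_one, two_two_seq_scalar_par_one, two_two_seq_scalar_par_one, one_two_seq_scalar_par_one, seq_scalar_par_one,
    -- Step F: (C1) backwards on `Gm(-π/4, π/4)`, then `(H ⊗ 𝕀) ⨾ (H ⊗ 𝕀) = 𝕀`
    ← seq_assoc ((mk (Z 1 2 1) ⊠ mk (Z 1 2 (-1))) ⨟ ((mk (wires 1) ⊠ ((mk hBox ⊠ mk (wires 1)) ⨟ mk cap)) ⊠ mk (wires 1))) (mk (xLeafL 0 1) ⊠ mk (xLeafR 4 (-1))) (mk (Z 2 1 0)),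
    ← seq_assoc (mk (wires 1) ⊠ mk hBox) _ (mk (Z 2 1 0)), ← seq_assoc (mk (wires 1) ⊠ mk hBox) _ (mk (xLeafL 0 1) ⊠ mk (xLeafR 4 (-1))),
    ← seq_assoc (mk (wires 1) ⊠ mk hBox) (mk (Z 1 2 1) ⊠ mk (Z 1 2 (-1))) ((mk (wires 1) ⊠ ((mk hBox ⊠ mk (wires 1)) ⨟ mk cap)) ⊠ mk (wires 1)), ← c1Gadget_eq_mirror]
  simp only [seq_assoc]
  rw [← seq_assoc (mk hBox ⊠ mk (wires 1)) (mk hBox ⊠ mk (wires 1)), hBox_par_seq_hBox_par, id_seq,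
    -- Step G: the `π`-split fuses with the two splits; the hedge becomes an `H`-loop
    par_eq_seq_left (mk (Z 1 2 (-1))) (mk (Z 1 2 1)), seq_assoc (mk (Z 1 2 (-1)) ⊠ mk (wires 1)), ← seq_assoc (mk (Z 1 2 4)) (mk (Z 1 2 (-1)) ⊠ mk (wires 1)),
    Z_seq_Z_par 1 1 1 2 le_rfl, show (-1 : ZMod 8) + 4 = 3 from by decide, ← seq_assoc (mk (Z 1 3 3)), Z_seq_par_Z 1 2 1 2 le_rfl, show (3 : ZMod 8) + 1 = 4 from by decide,
    show mk (Z 1 4 4) = mk (Z 1 2 4) ⨟ (mk (Z 1 3 0) ⊠ mk (wires 1)) from by rw [Z_seq_Z_par 1 1 1 3 le_rfl, zero_add],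
    seq_assoc (mk (Z 1 2 4)), ← seq_assoc (mk (Z 1 3 0) ⊠ mk (wires 1)) ((mk (wires 1) ⊠ ((mk hBox ⊠ mk (wires 1)) ⨟ mk cap)) ⊠ mk (wires 1)), ← seq_par_wires, hLoop_div, scalar_par_one_par_one, scalar_par_two_two_seq_one,
    one_two_seq_scalar_par_one, ← seq_assoc (mk (Z 1 2 4)) (mk (Z 1 1 4) ⊠ mk (wires 1)), Z_seq_Z_par 1 1 1 1 le_rfl, show (4 : ZMod 8) + 4 = 0 from by decide,
    seq_scalar_par_one, ← xLeafL_eq_xLeafR 0 1, sqrt_two_par_invSqrtTwo_par_one, ← xLeafL_eq_xLeafR 4 (-1), show mk (Z 1 (1 + 1) 0) = mk (Z 1 2 0) from rfl]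
  where
  hLoop_div : mk (Z 1 3 0) ⨟ (mk (wires 1) ⊠ ((mk hBox ⊠ mk (wires 1)) ⨟ mk cap)) = mk invSqrtTwo ⊠ mk (Z 1 1 4) := by
    have h := congrArg (mk invSqrtTwo ⊠ ·) sqrt_two_par_hLoop
    rw [invSqrtTwo_par_sqrt_two_par_one] at h
    exact h

/-- `1/√2` is its own transpose (diagram-level transpose under `mk`). [folklore] -/
theorem mk_transpose_invSqrtTwo : mk invSqrtTwo.transpose = mk invSqrtTwo := by
  simp only [invSqrtTwo, ZXDiagram.transpose_seq, ZXDiagram.transpose_Z, ZXDiagram.transpose_X, mk_seq]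
  exact invSqrtTwo_eq_red.symm

/-- The green `π/2` effect is the red `-π/2` effect: `Z^{(1,0)}(π/2) = db 4 1 ⊗ 1/√2 ⊗ X^{(1,0)}(-π/2)`. [cite: JeandelPerdrixVilmart2018, Appendix Lemma 15] -/
theorem Z_effect_two_eq : mk (Z 1 0 2) = mk (dumbbell 4 1) ⊠ (mk invSqrtTwo ⊠ mk (X 1 0 (-2))) := by
  have h := congrArg transpose Z_state_two_eq
  simpa [mk_transpose_dumbbell, mk_transpose_invSqrtTwo] using h

/-- **A leaf of phase `π/2` is a red phase**: `xLeafL 0 (π/2) = db 4 1 ⊗ 1/√2 ⊗ X(-π/2)`. [cite: JeandelPerdrixVilmart2018, Appendix Lemma 15] -/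
theorem xLeafL_zero_two : mk (xLeafL 0 2) = mk (dumbbell 4 1) ⊠ (mk invSqrtTwo ⊠ mk (X 1 1 (-2))) := by
  have hX : mk (X 1 2 0) ⨟ (mk (X 1 0 (-2)) ⊠ mk (wires 1)) = mk (X 1 1 (-2)) := by
    have h := congrArg colorSwap (show mk (Z 1 2 0) ⨟ (mk (Z 1 0 (-2)) ⊠ mk (wires 1)) = mk (Z 1 1 (-2)) from by rw [Z_seq_Z_par 1 1 1 0 le_rfl, add_zero])
    simpa using h
  simp only [xLeafL, mk_seq, mk_par]
  rw [Z_effect_two_eq, show ∀ (s t : ZXClass 0 0) (E : ZXClass 1 0), (s ⊠ (t ⊠ E)) ⊠ mk (wires 1) = s ⊠ (t ⊠ (E ⊠ mk (wires 1))) from fun s t E => by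
      rw [show (s ⊠ (t ⊠ E)) ⊠ mk (wires 1) = s ⊠ ((t ⊠ E) ⊠ mk (wires 1)) from (par_assoc _ _ _).trans (cast_id _ _ _)]
      exact congrArg (s ⊠ ·) ((par_assoc _ _ _).trans (cast_id _ _ _)),
    one_two_seq_scalar_par_one, one_two_seq_scalar_par_one, hX]

/-- **Tail of the two-triangle cycle**: `X(π/2) ⨾ Z^{(1,2)} ⨾ (xLeafL π (-π/4) ⊗ xLeafL 0 (π/4)) ⨾ Z^{(2,1)} = 1/√2 ⊗ 𝕀`
(leaf flip, the leafy four-cycle, and the `π/2`-leaf). [cite: JeandelPerdrixVilmart2018, Fig. 1 (B2), (K)] -/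
theorem two_triangle_tail :
    mk (X 1 1 2) ⨟ mk (Z 1 2 0) ⨟ (mk (xLeafL 4 (-1)) ⊠ mk (xLeafL 0 1)) ⨟ mk (Z 2 1 0) = mk invSqrtTwo ⊠ mk (wires 1) := by
  have hK : mk (dumbbell 0 0) ⊠ mk (xLeafL 4 (-1)) = mk (dumbbell 4 (-1)) ⊠ mk (xLeafL 0 1) := by
    simpa using (dumbbell_four_par_xLeafL_neg 0 (-1)).symm
  refine cancel_sqrt_two_left (cancel_sqrt_two_left ?_)
  rw [seq_assoc, seq_assoc, ← seq_scalar_par_one (mk (dumbbell 0 0)) (mk (X 1 1 2)), ← seq_scalar_par_one (mk (dumbbell 0 0)) (mk (X 1 1 2)),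
    ← one_two_seq_scalar_par_one (mk (Z 1 2 0)) (mk (dumbbell 0 0)), ← scalar_par_two_two_seq_one (mk (dumbbell 0 0)) (mk (xLeafL 4 (-1)) ⊠ mk (xLeafL 0 1)),
    ← scalar_par_one_par_one, hK, scalar_par_one_par_one, scalar_par_two_two_seq_one, one_two_seq_scalar_par_one,
    scalar_par_scalar_par (mk (dumbbell 0 0)) (mk (dumbbell 4 (-1))), ← seq_assoc (mk (Z 1 2 0)), leafy_four_cycle, show (1 : ZMod 8) + 1 = 2 from by decide,
    xLeafL_zero_two, seq_scalar_par_one, seq_scalar_par_one, seq_scalar_par_one, xphase_seq_xphase, show (2 : ZMod 8) + -2 = 0 from by decide, X_one_one,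
    show ∀ Y : ZXClass 1 1, mk (dumbbell 4 (-1)) ⊠ (mk (dumbbell 4 1) ⊠ Y) = (mk (dumbbell 4 (-1)) ⊠ mk (dumbbell 4 1)) ⊠ Y from fun Y => (par_assoc' _ _ _).trans (cast_id _ _ _),
    dumbbell_four_mul, show (-1 : ZMod 8) + 1 = 0 from by decide, dumbbell_four_zero,
    show ∀ Y : ZXClass 1 1, (mk (dumbbell 0 0) ⊠ mk (dumbbell 0 0)) ⊠ Y = mk (dumbbell 0 0) ⊠ (mk (dumbbell 0 0) ⊠ Y) from fun Y => (par_assoc _ _ _).trans (cast_id _ _ _),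
    scalar_par_scalar_par (mk (dumbbell 0 0)) (mk invSqrtTwo), sqrt_two_par_invSqrtTwo_par_one]

/-- The `π`-conjugated leaf chain: `xLeafL π (π/4) ⨾ Z(π/4) ⨾ X(π) = 1/√2 ⊗ db 4 1 ⊗ (xLeafL 0 (π/4) ⨾ Z(-π/4))` ((K)).
[cite: JeandelPerdrixVilmart2018, Fig. 1 (K)] -/
theorem xLeafL_four_seq_Z_seq_X_pi : mk (xLeafL 4 1) ⨟ mk (Z 1 1 1) ⨟ mk (X 1 1 4) = mk invSqrtTwo ⊠ (mk (dumbbell 4 1) ⊠ (mk (xLeafL 0 1) ⨟ mk (Z 1 1 (-1)))) := by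
  have hK : mk (X 1 1 4) ⨟ mk (Z 1 1 1) = mk invSqrtTwo ⊠ (mk (dumbbell 4 1) ⊠ (mk (Z 1 1 (-1)) ⨟ mk (X 1 1 4))) := by
    have h := congrArg (mk invSqrtTwo ⊠ ·) (rule_K_red 1)
    rw [invSqrtTwo_par_sqrt_two_par_one] at h
    exact h
  rw [← xLeafL_zero_seq_X_pi, seq_assoc (mk (xLeafL 0 1)) (mk (X 1 1 4)) (mk (Z 1 1 1)), hK, seq_scalar_par_one, seq_scalar_par_one,
    scalar_par_seq_one, scalar_par_seq_one, seq_assoc, seq_assoc, xphase_seq_xphase, show (4 : ZMod 8) + 4 = 0 from by decide, X_one_one, seq_id]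

/-- **JPV LICS 2019, Lemma `2-triangle-cycle`**: `Z^{(1,2)} ⨾ (T ⊗ Tᵗ) ⨾ Z^{(2,1)} = 𝕀`.
[cite: JeandelPerdrixVilmart2018, §6 (triangle); JPV LICS 2019 Appendix, Lemma 2-triangle-cycle] -/
theorem two_triangle_cycle : mk (Z 1 2 0) ⨟ (mk triangle ⊠ (mk triangle).transpose) ⨟ mk (Z 2 1 0) = mk (wires 1) := by
  -- the core (transposed back): `db 4 (-1) ⊗ (Z12 ⨾ ((xL ⨾ Z1 ⨾ X2) ⊗ (xL ⨾ Z(-1) ⨾ X2)) ⨾ Z21) = 𝕀`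
  have h1 : mk (dumbbell 4 (-1)) ⊠ (mk (Z 1 2 0) ⨟ ((mk (X 1 1 2) ⨟ mk (Z 1 1 1) ⨟ mk (xLeafL 0 1)) ⊠ (mk (X 1 1 2) ⨟ mk (Z 1 1 (-1)) ⨟ mk (xLeafL 0 1))) ⨟ mk (Z 2 1 0)) = mk (wires 1) := by
    rw [two_triangle_core, two_triangle_tail, sqrt_two_par_invSqrtTwo_par_one]
  have hAt := congrArg transpose h1
  simp [mk_transpose_dumbbell, mk_transpose_xLeafL] at hAt
  -- the prelude: the two gadgets cancel through the `X(π)`'s of `Tᵗ = X(π) ⨾ T ⨾ X(π)`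
  have hT : mk triangle = (mk (Z 1 2 0) ⨟ (mk (wires 1) ⊠ (mk (X 1 2 0) ⨟ (mk (Z 1 0 (-1)) ⊠ mk (Z 1 0 (-1)))))) ⨟ (mk (xLeafL 0 1) ⨟ mk (Z 1 1 1) ⨟ mk (X 1 1 2)) := by
    rw [mk_triangle, seq_assoc, seq_assoc, ← seq_assoc (mk (xLeafL 0 1))]
  have hP : mk (Z 1 2 0) ⨟ (mk triangle ⊠ (mk triangle).transpose) ⨟ mk (Z 2 1 0) =
      mk (dumbbell 4 (-2)) ⊠ (mk (Z 1 2 0) ⨟ ((mk (xLeafL 0 1) ⨟ mk (Z 1 1 1) ⨟ mk (X 1 1 2)) ⊠ (mk (xLeafL 4 1) ⨟ mk (Z 1 1 1) ⨟ mk (X 1 1 6))) ⨟ mk (Z 2 1 0)) := by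
    rw [triangle_transpose_eq, hT,
      -- gadget of the first branch to the input
      show ((mk (Z 1 2 0) ⨟ (mk (wires 1) ⊠ (mk (X 1 2 0) ⨟ (mk (Z 1 0 (-1)) ⊠ mk (Z 1 0 (-1)))))) ⨟ (mk (xLeafL 0 1) ⨟ mk (Z 1 1 1) ⨟ mk (X 1 1 2))) ⊠ ((mk (X 1 1 4) ⨟ ((mk (Z 1 2 0) ⨟ (mk (wires 1) ⊠ (mk (X 1 2 0) ⨟ (mk (Z 1 0 (-1)) ⊠ mk (Z 1 0 (-1)))))) ⨟ (mk (xLeafL 0 1) ⨟ mk (Z 1 1 1) ⨟ mk (X 1 1 2)))) ⨟ mk (X 1 1 4)) = ((mk (Z 1 2 0) ⨟ (mk (wires 1) ⊠ (mk (X 1 2 0) ⨟ (mk (Z 1 0 (-1)) ⊠ mk (Z 1 0 (-1)))))) ⊠ mk (wires 1)) ⨟ ((mk (xLeafL 0 1) ⨟ mk (Z 1 1 1) ⨟ mk (X 1 1 2)) ⊠ ((mk (X 1 1 4) ⨟ ((mk (Z 1 2 0) ⨟ (mk (wires 1) ⊠ (mk (X 1 2 0) ⨟ (mk (Z 1 0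 (-1)) ⊠ mk (Z 1 0 (-1)))))) ⨟ (mk (xLeafL 0 1) ⨟ mk (Z 1 1 1) ⨟ mk (X 1 1 2)))) ⨟ mk (X 1 1 4))) from by
        rw [interchange, id_seq],
      ← seq_assoc (mk (Z 1 2 0)), split_seq_gadget_par,
      -- the leading `X(π)` of the second branch through the copy
      seq_assoc (mk (X 1 1 4)) ((mk (Z 1 2 0) ⨟ (mk (wires 1) ⊠ (mk (X 1 2 0) ⨟ (mk (Z 1 0 (-1)) ⊠ mk (Z 1 0 (-1)))))) ⨟ (mk (xLeafL 0 1) ⨟ mk (Z 1 1 1) ⨟ mk (X 1 1 2))) (mk (X 1 1 4)),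
      show (mk (xLeafL 0 1) ⨟ mk (Z 1 1 1) ⨟ mk (X 1 1 2)) ⊠ (mk (X 1 1 4) ⨟ (((mk (Z 1 2 0) ⨟ (mk (wires 1) ⊠ (mk (X 1 2 0) ⨟ (mk (Z 1 0 (-1)) ⊠ mk (Z 1 0 (-1)))))) ⨟ (mk (xLeafL 0 1) ⨟ mk (Z 1 1 1) ⨟ mk (X 1 1 2))) ⨟ mk (X 1 1 4))) = (mk (wires 1) ⊠ mk (X 1 1 4)) ⨟ ((mk (xLeafL 0 1) ⨟ mk (Z 1 1 1) ⨟ mk (X 1 1 2)) ⊠ (((mk (Z 1 2 0) ⨟ (mk (wires 1) ⊠ (mk (X 1 2 0) ⨟ (mk (Z 1 0 (-1)) ⊠ mk (Z 1 0 (-1)))))) ⨟ (mk (xLeafL 0 1) ⨟ mk (Z 1 1 1) ⨟ mk (X 1 1 2))) ⨟ mk (X 1 1 4))) from by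
        rw [interchange, id_seq],
      seq_assoc (mk (Z 1 2 0) ⨟ (mk (wires 1) ⊠ (mk (X 1 2 0) ⨟ (mk (Z 1 0 (-1)) ⊠ mk (Z 1 0 (-1)))))) (mk (Z 1 2 0)), ← seq_assoc (mk (Z 1 2 0)) (mk (wires 1) ⊠ mk (X 1 1 4)), split_seq_par_X_pi,
      seq_assoc (mk (X 1 1 4) ⨟ mk (Z 1 2 0)) (mk (X 1 1 4) ⊠ mk (wires 1)),
      show (mk (X 1 1 4) ⊠ mk (wires 1)) ⨟ ((mk (xLeafL 0 1) ⨟ mk (Z 1 1 1) ⨟ mk (X 1 1 2)) ⊠ (((mk (Z 1 2 0) ⨟ (mk (wires 1) ⊠ (mk (X 1 2 0) ⨟ (mk (Z 1 0 (-1)) ⊠ mk (Z 1 0 (-1)))))) ⨟ (mk (xLeafL 0 1) ⨟ mk (Z 1 1 1) ⨟ mk (X 1 1 2))) ⨟ mk (X 1 1 4))) = (mk (X 1 1 4) ⨟ (mk (xLeafL 0 1) ⨟ mk (Z 1 1 1) ⨟ mk (X 1 1 2))) ⊠ (((mk (Z 1 2 0) ⨟ (mk (wires 1) ⊠ (mk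 (X 1 2 0) ⨟ (mk (Z 1 0 (-1)) ⊠ mk (Z 1 0 (-1)))))) ⨟ (mk (xLeafL 0 1) ⨟ mk (Z 1 1 1) ⨟ mk (X 1 1 2))) ⨟ mk (X 1 1 4)) from by
        rw [interchange, id_seq],
      -- gadget of the second branch to the input
      seq_assoc (mk (Z 1 2 0) ⨟ (mk (wires 1) ⊠ (mk (X 1 2 0) ⨟ (mk (Z 1 0 (-1)) ⊠ mk (Z 1 0 (-1)))))) (mk (xLeafL 0 1) ⨟ mk (Z 1 1 1) ⨟ mk (X 1 1 2)) (mk (X 1 1 4)),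
      show (mk (X 1 1 4) ⨟ (mk (xLeafL 0 1) ⨟ mk (Z 1 1 1) ⨟ mk (X 1 1 2))) ⊠ ((mk (Z 1 2 0) ⨟ (mk (wires 1) ⊠ (mk (X 1 2 0) ⨟ (mk (Z 1 0 (-1)) ⊠ mk (Z 1 0 (-1)))))) ⨟ ((mk (xLeafL 0 1) ⨟ mk (Z 1 1 1) ⨟ mk (X 1 1 2)) ⨟ mk (X 1 1 4))) = (mk (wires 1) ⊠ (mk (Z 1 2 0) ⨟ (mk (wires 1) ⊠ (mk (X 1 2 0) ⨟ (mk (Z 1 0 (-1)) ⊠ mk (Z 1 0 (-1))))))) ⨟ ((mk (X 1 1 4) ⨟ (mk (xLeafL 0 1) ⨟ mk (Z 1 1 1) ⨟ mk (X 1 1 2))) ⊠ ((mk (xLeafL 0 1) ⨟ mk (Z 1 1 1) ⨟ mk (X 1 1 2)) ⨟ mk (X 1 1 4))) from by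
        rw [interchange, id_seq],
      seq_assoc (mk (X 1 1 4)) (mk (Z 1 2 0)), ← seq_assoc (mk (Z 1 2 0)) (mk (wires 1) ⊠ (mk (Z 1 2 0) ⨟ (mk (wires 1) ⊠ (mk (X 1 2 0) ⨟ (mk (Z 1 0 (-1)) ⊠ mk (Z 1 0 (-1))))))), split_seq_par_gadget,
      -- `Gn ⨾ X(π) ⨾ Gn = X(π) ⨾ Gnπ ⨾ Gn = db 4 (-2) ⊗ X(π)`
      seq_assoc (mk (Z 1 2 0) ⨟ (mk (wires 1) ⊠ (mk (X 1 2 0) ⨟ (mk (Z 1 0 (-1)) ⊠ mk (Z 1 0 (-1)))))) (mk (Z 1 2 0)), ← seq_assoc (mk (X 1 1 4)) (mk (Z 1 2 0) ⨟ (mk (wires 1) ⊠ (mk (X 1 2 0) ⨟ (mk (Z 1 0 (-1)) ⊠ mk (Z 1 0 (-1)))))), ← seq_assoc (mk (Z 1 2 0) ⨟ (mk (wires 1) ⊠ (mk (X 1 2 0) ⨟ (mk (Z 1 0 (-1)) ⊠ mk (Z 1 0 (-1)))))) (mk (X 1 1 4) ⨟ (mk (Z 1 2 0) ⨟ (mk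 (wires 1) ⊠ (mk (X 1 2 0) ⨟ (mk (Z 1 0 (-1)) ⊠ mk (Z 1 0 (-1))))))), ← seq_assoc (mk (Z 1 2 0) ⨟ (mk (wires 1) ⊠ (mk (X 1 2 0) ⨟ (mk (Z 1 0 (-1)) ⊠ mk (Z 1 0 (-1)))))) (mk (X 1 1 4)) (mk (Z 1 2 0) ⨟ (mk (wires 1) ⊠ (mk (X 1 2 0) ⨟ (mk (Z 1 0 (-1)) ⊠ mk (Z 1 0 (-1)))))),
      gadgetNode_seq_X_pi, seq_assoc (mk (X 1 1 4)) (mk (Z 1 2 0) ⨟ (mk (wires 1) ⊠ (mk (X 1 2 4) ⨟ (mk (Z 1 0 (-1)) ⊠ mk (Z 1 0 (-1)))))) (mk (Z 1 2 0) ⨟ (mk (wires 1) ⊠ (mk (X 1 2 0) ⨟ (mk (Z 1 0 (-1)) ⊠ mk (Z 1 0 (-1)))))), gadgetNode_pi_seq_gadgetNode, seq_scalar_par_one, seq_id,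
      show ∀ (t : ZXClass 0 0) (A : ZXClass 1 1) (B : ZXClass 1 2), (t ⊠ A) ⨟ B = t ⊠ (A ⨟ B) from fun t A B => by rw [scalar_par_seq_left, empty_par, cast_id],
      scalar_par_one_two_seq_one,
      -- the `X(π)` into the copy and onto the branches
      ← seq_assoc (mk (X 1 1 4)) (mk (Z 1 2 0)), K1_red, seq_assoc (mk (Z 1 2 0)) (mk (X 1 1 4) ⊠ mk (X 1 1 4)),
      interchange, ← seq_assoc (mk (X 1 1 4)) (mk (X 1 1 4)) (mk (xLeafL 0 1) ⨟ mk (Z 1 1 1) ⨟ mk (X 1 1 2)), xphase_seq_xphase,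
      show (4 : ZMod 8) + 4 = 0 from by decide, X_one_one, id_seq, ← seq_assoc (mk (X 1 1 4)) (mk (xLeafL 0 1) ⨟ mk (Z 1 1 1) ⨟ mk (X 1 1 2)) (mk (X 1 1 4)),
      ← seq_assoc (mk (X 1 1 4)) (mk (xLeafL 0 1) ⨟ mk (Z 1 1 1)) (mk (X 1 1 2)), ← seq_assoc (mk (X 1 1 4)) (mk (xLeafL 0 1)) (mk (Z 1 1 1)), X_pi_seq_xLeafL,
      seq_assoc _ (mk (X 1 1 2)) (mk (X 1 1 4)), xphase_seq_xphase, show (2 : ZMod 8) + 4 = 6 from by decide]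
  refine cancel_dumbbell_four_one_one (-1) ?_
  rw [hP, seq_assoc (mk (xLeafL 4 1)) (mk (Z 1 1 1)) (mk (X 1 1 6)), show mk (X 1 1 6) = mk (X 1 1 4) ⨟ mk (X 1 1 2) from by rw [xphase_seq_xphase]; rfl,
    ← seq_assoc (mk (Z 1 1 1)) (mk (X 1 1 4)) (mk (X 1 1 2)), ← seq_assoc (mk (xLeafL 4 1)) (mk (Z 1 1 1) ⨟ mk (X 1 1 4)) (mk (X 1 1 2)),
    ← seq_assoc (mk (xLeafL 4 1)) (mk (Z 1 1 1)) (mk (X 1 1 4)), xLeafL_four_seq_Z_seq_X_pi, scalar_par_seq_one, scalar_par_seq_one, hRl', hRl',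
    one_two_seq_scalar_par_two, one_two_seq_scalar_par_two, scalar_par_one_two_seq_one, scalar_par_one_two_seq_one,
    seq_assoc (mk (xLeafL 0 1)) (mk (Z 1 1 (-1))) (mk (X 1 1 2)), seq_assoc (mk (xLeafL 0 1)) (mk (Z 1 1 1)) (mk (X 1 1 2)),
    scalar_par_scalar_par (mk (dumbbell 4 (-1))) (mk (dumbbell 4 (-2))), scalar_par_scalar_par (mk (dumbbell 4 (-1))) (mk invSqrtTwo),
    scalar_par_scalar_par (mk (dumbbell 4 (-1))) (mk (dumbbell 4 1))]
  simp only [seq_assoc]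
  rw [hAt, show ∀ Y : ZXClass 1 1, mk (dumbbell 4 (-2)) ⊠ (mk invSqrtTwo ⊠ (mk (dumbbell 4 1) ⊠ Y)) = mk invSqrtTwo ⊠ ((mk (dumbbell 4 (-2)) ⊠ mk (dumbbell 4 1)) ⊠ Y) from fun Y => by
      rw [scalar_par_scalar_par (mk (dumbbell 4 (-2))) (mk invSqrtTwo)]; exact congrArg (mk invSqrtTwo ⊠ ·) ((par_assoc' _ _ _).trans (cast_id _ _ _)),
    dumbbell_four_mul, show (-2 : ZMod 8) + 1 = -1 from by decide,
    show ∀ Y : ZXClass 1 1, (mk (dumbbell 4 (-1)) ⊠ mk (dumbbell 0 0)) ⊠ Y = mk (dumbbell 4 (-1)) ⊠ (mk (dumbbell 0 0) ⊠ Y) from fun Y => (par_assoc _ _ _).trans (cast_id _ _ _),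
    scalar_par_scalar_par (mk invSqrtTwo) (mk (dumbbell 4 (-1))), invSqrtTwo_par_sqrt_two_par_one]
  where
  hRl' (A B : ZXClass 1 1) (t : ZXClass 0 0) : A ⊠ (t ⊠ B) = t ⊠ (A ⊠ B) := by
    rw [show A ⊠ (t ⊠ B) = (A ⊠ t) ⊠ B from (par_assoc' _ _ _).trans (cast_id _ _ _), ← scalar_par_one_comm]
    exact (par_assoc _ _ _).trans (cast_id _ _ _)

end ZXClass

end Literature.Computability.QuantumComplexity
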